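import Mathlib
import HarnessLib
import Summits.AtomisticToContinuum.FouriersLaw.Theses.JunctionLocality
import Summits.AtomisticToContinuum.FouriersLaw.Theorems.JunctionLocalityConductanceLowerBoundCertificatePrincipleField
import Summits.AtomisticToContinuum.FouriersLaw.Theorems.JunctionLocalityConductanceLowerBoundOddFieldFrame

/-!
# The certificate principle for the transmission-gradient floor, II: the inf-side variational principle and the crux
(crux stmt-AtomisticToContinuum-11749, line `ForecastSensitivitySketch`)

Helper file (`--supports stmt-AtomisticToContinuum-11749`, lead c5).  Setting as in part I (`…CertificatePrincipleField`):
`pinnedChain ω₂ lam β γ` (`ω₂ > 0`, `lam, β ≥ 0`, `γ > 0`), `T > 0`, `L ≥ 2`, `μ_T = gibbsMeasure L T`, contacts `b ∈ {0, L−1}`,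
admissible pairs `(φ, χ)` (`γ S_B φ + X_H χ = −(p_0² − T)`), left forward field `g` (`X_H g + γ S_B g = −(p_0² − T)`), whose
far-contact Dirichlet energy `E_far = ‖∂_{p_{L−1}} g‖²` carries the crux (`D_L = (L−1)(2γ³/T) E_far`, landed).

* `certificate_principle` — THE INF-SIDE VARIATIONAL PRINCIPLE: `E_near(g) + E_far(g) ≤ Σ_b (‖∂_{p_b} φ‖² + ‖∂_{p_b} χ‖²)` for every
  admissible pair (equality at `((g+g∘Θ)/2, (g−g∘Θ)/2)`).  Proof: part I's pairing of the constraint with `g` (`σ = 1`) and with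
  `g∘Θ` (`σ = −1`), the carré du champ `⟨g, p_0²−T⟩ = γT(E_near + E_far)`, reversal invariance, AM–GM.
* `farGradient_sq_ge_of_certificate` — with the landed sum rule `E_near = T/γ² − 3E_far`: `E_far ≥ (T/γ² − cost)/2`.
* `floor_of_certificates`, `conductanceLowerBound_of_certificates` — admissible pairs of cost `≤ T/γ² − c/(L−1)` for all large `L`
  imply the floor (constant `c/2`) and hence the crux (`conductanceLowerBound_of_floor`).  This is the typed target for any
  certificate-style attack on stmt-11749; the companion `…CertificateObstruction` file records what such pairs must look like.

No new definitions, no named facts, no sorry.  References: Bernardin–Olla 2011 §6; Komorowski–Landim–Olla 2012 §4.2; folklore.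
-/

noncomputable section

open MeasureTheory Filter Topology
open scoped ContDiff
open Literature.MathematicalPhysics.KineticTheory.HeatConduction
open Summit.AtomisticToContinuum.FouriersLaw.Theorems.SuperadditiveResistance.DeviceLiouville
  (kin kin_eq_sq continuous_kin liouvilleOp bathOp continuous_liouvilleOp continuous_bathOp
    generator_eq_liouvilleOp_add)
open Summit.AtomisticToContinuum.FouriersLaw.Theorems.SuperadditiveResistance.Kubo
  (chi contDiff_chi hasCompactSupport_chi tendsto_integral_chi_mul tendsto_integral_partialP_chi_mul
    integral_chi_mul_bathOp integral_chi_liouville_antisymm memLp_partialP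
    integrable_mul_mul_gibbsDensity integrable_sq_mul_gibbsDensity memLp_momentum memLp_kinetic
    rev rev_apply contDiff_rev memLp_rev rev_pair partialP_rev integral_rev_mul_gibbsDensity)

namespace Summit.AtomisticToContinuum.FouriersLaw.Cruxes.ConductanceLowerBound.ForecastSensitivity

variable {ω₂ lam β γ T : ℝ}


/-! ## §2 The certificate principle: `E_near(g) + E_far(g) ≤ cost(φ, χ)` -/

/-- AM–GM for the four pairings of one contact: for `a, ã, p, c ∈ L²(μ_T)`,
`∫ a p ρ + ∫ ã p ρ + ∫ c a ρ − ∫ c ã ρ ≤ ½ ∫ a² ρ + ½ ∫ ã² ρ + ∫ p² ρ + ∫ c² ρ`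
(integrate `0 ≤ ((a+ã)/2 − p)² + ((a−ã)/2 − c)²`). [folklore] -/
theorem integral_pairings_le_cost (hω : 0 < ω₂) (hl : 0 ≤ lam) (hβ : 0 ≤ β) (hT : 0 < T) {L : ℕ}
    {a a' p c : PhaseSpace L → ℝ} (ha : MemLp a 2 ((pinnedChain ω₂ lam β γ).gibbsMeasure L T)) (ha' : MemLp a' 2 ((pinnedChain ω₂ lam β γ).gibbsMeasure L T))
    (hp : MemLp p 2 ((pinnedChain ω₂ lam β γ).gibbsMeasure L T)) (hc : MemLp c 2 ((pinnedChain ω₂ lam β γ).gibbsMeasure L T)) :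
    (∫ x, a x * p x * (pinnedChain ω₂ lam β γ).gibbsDensity L T x) + (∫ x, a' x * p x * (pinnedChain ω₂ lam β γ).gibbsDensity L T x) +
        (∫ x, c x * a x * (pinnedChain ω₂ lam β γ).gibbsDensity L T x) - ∫ x, c x * a' x * (pinnedChain ω₂ lam β γ).gibbsDensity L T x ≤
      (1 / 2) * (∫ x, a x ^ 2 * (pinnedChain ω₂ lam β γ).gibbsDensity L T x) + (1 / 2) * (∫ x, a' x ^ 2 * (pinnedChain ω₂ lam β γ).gibbsDensity L T x) +
        (∫ x, p x ^ 2 * (pinnedChain ω₂ lam β γ).gibbsDensity L T x) + ∫ x, c x ^ 2 * (pinnedChain ω₂ lam β γ).gibbsDensity L T x := by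
  have iap := integrable_mul_mul_gibbsDensity hω hl hβ γ L hT ha hp
  have ia'p := integrable_mul_mul_gibbsDensity hω hl hβ γ L hT ha' hp
  have ica := integrable_mul_mul_gibbsDensity hω hl hβ γ L hT hc ha
  have ica' := integrable_mul_mul_gibbsDensity hω hl hβ γ L hT hc ha'
  have ia2 := integrable_sq_mul_gibbsDensity hω hl hβ γ L hT ha
  have ia'2 := integrable_sq_mul_gibbsDensity hω hl hβ γ L hT ha'
  have ip2 := integrable_sq_mul_gibbsDensity hω hl hβ γ L hT hp
  have ic2 := integrable_sq_mul_gibbsDensity hω hl hβ γ L hT hc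
  have hnn : 0 ≤ ∫ x, (((a x + a' x) / 2 - p x) ^ 2 + ((a x - a' x) / 2 - c x) ^ 2) * (pinnedChain ω₂ lam β γ).gibbsDensity L T x :=
    integral_nonneg fun x => mul_nonneg (by positivity) ((pinnedChain ω₂ lam β γ).gibbsDensity_pos L T x).le
  have e : (fun x => (((a x + a' x) / 2 - p x) ^ 2 + ((a x - a' x) / 2 - c x) ^ 2) * (pinnedChain ω₂ lam β γ).gibbsDensity L T x) =
      fun x => ((1 / 2) * (a x ^ 2 * (pinnedChain ω₂ lam β γ).gibbsDensity L T x) + (1 / 2) * (a' x ^ 2 * (pinnedChain ω₂ lam β γ).gibbsDensity L T x) +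
        p x ^ 2 * (pinnedChain ω₂ lam β γ).gibbsDensity L T x + c x ^ 2 * (pinnedChain ω₂ lam β γ).gibbsDensity L T x) -
        (a x * p x * (pinnedChain ω₂ lam β γ).gibbsDensity L T x + a' x * p x * (pinnedChain ω₂ lam β γ).gibbsDensity L T x +
          c x * a x * (pinnedChain ω₂ lam β γ).gibbsDensity L T x - c x * a' x * (pinnedChain ω₂ lam β γ).gibbsDensity L T x) := by
    funext x; ring
  have j1 : Integrable fun x => (1 / 2) * (a x ^ 2 * (pinnedChain ω₂ lam β γ).gibbsDensity L T x) +
      (1 / 2) * (a' x ^ 2 * (pinnedChain ω₂ lam β γ).gibbsDensity L T x) + p x ^ 2 * (pinnedChain ω₂ lam β γ).gibbsDensity L T x +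
      c x ^ 2 * (pinnedChain ω₂ lam β γ).gibbsDensity L T x := (((ia2.const_mul _).add (ia'2.const_mul _)).add ip2).add ic2
  have j2 : Integrable fun x => a x * p x * (pinnedChain ω₂ lam β γ).gibbsDensity L T x + a' x * p x * (pinnedChain ω₂ lam β γ).gibbsDensity L T x +
      c x * a x * (pinnedChain ω₂ lam β γ).gibbsDensity L T x - c x * a' x * (pinnedChain ω₂ lam β γ).gibbsDensity L T x := ((iap.add ia'p).add ica).sub ica'
  have s1 : ∫ x, ((1 / 2) * (a x ^ 2 * (pinnedChain ω₂ lam β γ).gibbsDensity L T x) + (1 / 2) * (a' x ^ 2 * (pinnedChain ω₂ lam β γ).gibbsDensity L T x) +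
        p x ^ 2 * (pinnedChain ω₂ lam β γ).gibbsDensity L T x + c x ^ 2 * (pinnedChain ω₂ lam β γ).gibbsDensity L T x) -
        (a x * p x * (pinnedChain ω₂ lam β γ).gibbsDensity L T x + a' x * p x * (pinnedChain ω₂ lam β γ).gibbsDensity L T x +
          c x * a x * (pinnedChain ω₂ lam β γ).gibbsDensity L T x - c x * a' x * (pinnedChain ω₂ lam β γ).gibbsDensity L T x) =
      (∫ x, (1 / 2) * (a x ^ 2 * (pinnedChain ω₂ lam β γ).gibbsDensity L T x) + (1 / 2) * (a' x ^ 2 * (pinnedChain ω₂ lam β γ).gibbsDensity L T x) +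
        p x ^ 2 * (pinnedChain ω₂ lam β γ).gibbsDensity L T x + c x ^ 2 * (pinnedChain ω₂ lam β γ).gibbsDensity L T x) -
        ∫ x, a x * p x * (pinnedChain ω₂ lam β γ).gibbsDensity L T x + a' x * p x * (pinnedChain ω₂ lam β γ).gibbsDensity L T x +
          c x * a x * (pinnedChain ω₂ lam β γ).gibbsDensity L T x - c x * a' x * (pinnedChain ω₂ lam β γ).gibbsDensity L T x := integral_sub j1 j2
  have j12 : Integrable fun x => (1 / 2) * (a x ^ 2 * (pinnedChain ω₂ lam β γ).gibbsDensity L T x) +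
      (1 / 2) * (a' x ^ 2 * (pinnedChain ω₂ lam β γ).gibbsDensity L T x) := (ia2.const_mul _).add (ia'2.const_mul _)
  have j123 : Integrable fun x => (1 / 2) * (a x ^ 2 * (pinnedChain ω₂ lam β γ).gibbsDensity L T x) +
      (1 / 2) * (a' x ^ 2 * (pinnedChain ω₂ lam β γ).gibbsDensity L T x) + p x ^ 2 * (pinnedChain ω₂ lam β γ).gibbsDensity L T x := j12.add ip2
  have s2 : ∫ x, (1 / 2) * (a x ^ 2 * (pinnedChain ω₂ lam β γ).gibbsDensity L T x) + (1 / 2) * (a' x ^ 2 * (pinnedChain ω₂ lam β γ).gibbsDensity L T x) +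
        p x ^ 2 * (pinnedChain ω₂ lam β γ).gibbsDensity L T x + c x ^ 2 * (pinnedChain ω₂ lam β γ).gibbsDensity L T x =
      (1 / 2) * (∫ x, a x ^ 2 * (pinnedChain ω₂ lam β γ).gibbsDensity L T x) + (1 / 2) * (∫ x, a' x ^ 2 * (pinnedChain ω₂ lam β γ).gibbsDensity L T x) +
        (∫ x, p x ^ 2 * (pinnedChain ω₂ lam β γ).gibbsDensity L T x) + ∫ x, c x ^ 2 * (pinnedChain ω₂ lam β γ).gibbsDensity L T x := by
    rw [integral_add j123 ic2, integral_add j12 ip2,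
      integral_add (ia2.const_mul (1 / 2)) (ia'2.const_mul (1 / 2)), integral_const_mul, integral_const_mul]
  have k12 : Integrable fun x => a x * p x * (pinnedChain ω₂ lam β γ).gibbsDensity L T x + a' x * p x * (pinnedChain ω₂ lam β γ).gibbsDensity L T x :=
    iap.add ia'p
  have k123 : Integrable fun x => a x * p x * (pinnedChain ω₂ lam β γ).gibbsDensity L T x + a' x * p x * (pinnedChain ω₂ lam β γ).gibbsDensity L T x +
      c x * a x * (pinnedChain ω₂ lam β γ).gibbsDensity L T x := k12.add ica
  have s3 : ∫ x, a x * p x * (pinnedChain ω₂ lam β γ).gibbsDensity L T x + a' x * p x * (pinnedChain ω₂ lam β γ).gibbsDensity L T x +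
        c x * a x * (pinnedChain ω₂ lam β γ).gibbsDensity L T x - c x * a' x * (pinnedChain ω₂ lam β γ).gibbsDensity L T x =
      (∫ x, a x * p x * (pinnedChain ω₂ lam β γ).gibbsDensity L T x) + (∫ x, a' x * p x * (pinnedChain ω₂ lam β γ).gibbsDensity L T x) +
        (∫ x, c x * a x * (pinnedChain ω₂ lam β γ).gibbsDensity L T x) - ∫ x, c x * a' x * (pinnedChain ω₂ lam β γ).gibbsDensity L T x := by
    rw [integral_sub k123 ica', integral_add k12 ica, integral_add iap ia'p]
  rw [e, s1, s2, s3] at hnn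
  linarith

/-- The source `p_0² − T` is even in the momenta. [folklore] -/
theorem kin_sub_neg_momentum {L : ℕ} (hL : 0 < L) (T : ℝ) (x : PhaseSpace L) :
    kin L 0 ((x.1, -x.2) : PhaseSpace L) - T = kin L 0 x - T := by
  simp only [kin_eq_sq hL, Pi.neg_apply, neg_sq]

/-- **THE CERTIFICATE PRINCIPLE (inf-side variational principle for the floor).**  For `pinnedChain ω₂ lam β γ`
(`ω₂ > 0`, `lam, β ≥ 0`, `γ > 0`), `T > 0`, `L ≥ 2`, every classical `C² ∩ L²(μ_T)` left forward field `g`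
(`L_{T,T} g = −(p_0² − T)`) and every admissible pair `(φ, χ)` (`φ, χ ∈ C²`, contact gradients in `L²(μ_T)`,
`χ ∈ L²(μ_T)`, `γ S_B φ + X_H χ = −(p_0² − T)` pointwise):

  `‖∂_{p_0} g‖² + ‖∂_{p_{L−1}} g‖² ≤ Σ_{b ∈ {0, L−1}} (‖∂_{p_b} φ‖² + ‖∂_{p_b} χ‖²)`   in `L²(μ_T)`.

Equality holds at the pair `((g + g∘Θ)/2, (g − g∘Θ)/2)`, `Θ` the momentum reversal.  Proof: pair the constraint
with `g` (a `1`-field) and with `g∘Θ` (a `(−1)`-field, `Kubo.rev_pair`) by `certificate_pairing_field` and add;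
the right-hand sides are `2⟨g, p_0²−T⟩ = 2γT(E_near + E_far)` (carré du champ `integral_mul_source_eq_dirichlet'`,
reversal invariance of `μ_T`); conclude by AM–GM (`integral_pairings_le_cost`) and `‖∂_b(g∘Θ)‖ = ‖∂_b g‖`. [folklore] -/
theorem certificate_principle (hω : 0 < ω₂) (hl : 0 ≤ lam) (hβ : 0 ≤ β) (hγ : 0 < γ) (hT : 0 < T)
    {L : ℕ} (hL : 2 ≤ L) {g : PhaseSpace L → ℝ} (hgC : ContDiff ℝ 2 g)
    (hgL2 : MemLp g 2 ((pinnedChain ω₂ lam β γ).gibbsMeasure L T))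
    (hgeq : ∀ x, (pinnedChain ω₂ lam β γ).generator L T T g x = -(kin L 0 x - T))
    {φ χ : PhaseSpace L → ℝ} (hφ : ContDiff ℝ 2 φ) (hχ : ContDiff ℝ 2 χ)
    (hφ0 : MemLp (partialP (⟨0, by omega⟩ : Fin L) φ) 2 ((pinnedChain ω₂ lam β γ).gibbsMeasure L T))
    (hφR : MemLp (partialP (⟨L - 1, by omega⟩ : Fin L) φ) 2 ((pinnedChain ω₂ lam β γ).gibbsMeasure L T))
    (hχ0 : MemLp (partialP (⟨0, by omega⟩ : Fin L) χ) 2 ((pinnedChain ω₂ lam β γ).gibbsMeasure L T))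
    (hχR : MemLp (partialP (⟨L - 1, by omega⟩ : Fin L) χ) 2 ((pinnedChain ω₂ lam β γ).gibbsMeasure L T))
    (hχ2 : MemLp χ 2 ((pinnedChain ω₂ lam β γ).gibbsMeasure L T))
    (hpair : ∀ x, γ * bathOp L (OscillatorChain.bathWeight L) T φ x +
      liouvilleOp (pinnedChain ω₂ lam β γ) L χ x = -(kin L 0 x - T)) :
    (∫ x, (partialP (⟨0, by omega⟩ : Fin L) g x) ^ 2 ∂((pinnedChain ω₂ lam β γ).gibbsMeasure L T)) +
        ∫ x, (partialP (⟨L - 1, by omega⟩ : Fin L) g x) ^ 2 ∂((pinnedChain ω₂ lam β γ).gibbsMeasure L T) ≤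
      ((∫ x, (partialP (⟨0, by omega⟩ : Fin L) φ x) ^ 2 ∂((pinnedChain ω₂ lam β γ).gibbsMeasure L T)) +
          ∫ x, (partialP (⟨L - 1, by omega⟩ : Fin L) φ x) ^ 2 ∂((pinnedChain ω₂ lam β γ).gibbsMeasure L T)) +
        ((∫ x, (partialP (⟨0, by omega⟩ : Fin L) χ x) ^ 2 ∂((pinnedChain ω₂ lam β γ).gibbsMeasure L T)) +
          ∫ x, (partialP (⟨L - 1, by omega⟩ : Fin L) χ x) ^ 2 ∂((pinnedChain ω₂ lam β γ).gibbsMeasure L T)) := by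
  have hL0 : 0 < L := by omega
  have hL1 : L - 1 < L := by omega
  set B := OscillatorChain.bathWeight L with hB
  set i0 : Fin L := ⟨0, hL0⟩ with hi0
  set iR : Fin L := ⟨L - 1, hL1⟩ with hiR
  have hBnn : ∀ i, 0 ≤ B i := bathWeight_nonneg L
  have hB0 : 0 < B i0 := bathWeight_pos_of_val (Or.inl rfl)
  have hBR : 0 < B iR := bathWeight_pos_of_val (Or.inr rfl)
  have hgc : Continuous g := hgC.continuous
  have hkc : Continuous (fun x : PhaseSpace L => kin L 0 x - T) := (continuous_kin 0).sub continuous_const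
  have hk2 : MemLp (fun x : PhaseSpace L => kin L 0 x - T) 2 ((pinnedChain ω₂ lam β γ).gibbsMeasure L T) :=
    (memLp_kinetic hω hl hβ L hT i0).ae_eq (ae_of_all _ fun x => by simp only [kin_eq_sq hL0]; rfl)
  -- g is a 1-field, g∘Θ a (−1)-field
  have hpde1 : ∀ x, 1 * liouvilleOp (pinnedChain ω₂ lam β γ) L g x + γ * bathOp L B T g x = -(kin L 0 x - T) := fun x => by
    rw [one_mul, ← hgeq x, generator_eq_liouvilleOp_add]; rfl
  set gt : PhaseSpace L → ℝ := rev g with hgt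
  have hgtC : ContDiff ℝ 2 gt := contDiff_rev hgC
  have hgtL2 : MemLp gt 2 ((pinnedChain ω₂ lam β γ).gibbsMeasure L T) := memLp_rev hω hl hβ L hT hgc hgL2
  have hpde2 : ∀ x, (-1) * liouvilleOp (pinnedChain ω₂ lam β γ) L gt x + γ * bathOp L B T gt x = -(kin L 0 x - T) := by
    intro x
    have h := rev_pair (pinnedChain ω₂ lam β γ) B T 1 γ (k := fun y => kin L 0 y - T) hpde1 x
    rw [rev_apply, kin_sub_neg_momentum hL0] at h
    simpa only [hgt, neg_mul, one_mul] using h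
  have hpde2' : ∀ x, (-1) * liouvilleOp (pinnedChain ω₂ lam β γ) L gt x + γ * bathOp L B T gt x = -(kin L 0 x - T) := hpde2
  -- the two pairings
  have P1 := certificate_pairing_field hω hl hβ hγ hT hL (σ := 1) (by norm_num) hgC hgL2 hpde1 hφ hχ hφ0 hφR
    hχ0 hχR hχ2 hpair
  have P2 := certificate_pairing_field hω hl hβ hγ hT hL (σ := -1) (by norm_num) hgtC hgtL2 hpde2' hφ hχ
    hφ0 hφR hχ0 hχR hχ2 hpair
  -- the Dirichlet identity ⟨g, u⟩ = γT (E₀ + E_R)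
  have D := integral_mul_source_eq_dirichlet' hω hl hβ hγ hT hgC hgL2 hkc hk2 hgeq
  rw [sum_bathWeight_mul' _ (b₀ := i0) (b₁ := iR) rfl rfl] at D
  -- reversal invariance: ⟨g∘Θ, u⟩ = ⟨g, u⟩ and ‖∂_b (g∘Θ)‖ = ‖∂_b g‖
  have R0 : ∫ x, gt x * (kin L 0 x - T) * (pinnedChain ω₂ lam β γ).gibbsDensity L T x =
      ∫ x, g x * (kin L 0 x - T) * (pinnedChain ω₂ lam β γ).gibbsDensity L T x := by
    rw [← integral_rev_mul_gibbsDensity (pinnedChain ω₂ lam β γ) T (fun y => g y * (kin L 0 y - T))]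
    refine integral_congr_ae (ae_of_all _ fun x => ?_)
    show gt x * (kin L 0 x - T) * _ = rev (fun y => g y * (kin L 0 y - T)) x * _
    rw [rev_apply, kin_sub_neg_momentum hL0]
    rfl
  have Rb : ∀ i : Fin L, ∫ x, partialP i gt x ^ 2 * (pinnedChain ω₂ lam β γ).gibbsDensity L T x =
      ∫ x, partialP i g x ^ 2 * (pinnedChain ω₂ lam β γ).gibbsDensity L T x := by
    intro i
    rw [← integral_rev_mul_gibbsDensity (pinnedChain ω₂ lam β γ) T (fun y => partialP i g y ^ 2)]
    refine integral_congr_ae (ae_of_all _ fun x => ?_)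
    show partialP i gt x ^ 2 * _ = rev (fun y => partialP i g y ^ 2) x * _
    rw [hgt, partialP_rev, rev_apply, neg_sq]
  -- L² membership of the field gradients
  have hdg : ∀ {i : Fin L}, 0 < B i → MemLp (partialP i g) 2 ((pinnedChain ω₂ lam β γ).gibbsMeasure L T) := fun {i} hi =>
    memLp_partialP hω hl hβ γ L hT B hBnn 1 hγ hgC hgL2 hk2 hpde1 hi
  have hdgt : ∀ {i : Fin L}, 0 < B i → MemLp (partialP i gt) 2 ((pinnedChain ω₂ lam β γ).gibbsMeasure L T) := fun {i} hi =>
    memLp_partialP hω hl hβ γ L hT B hBnn (-1) hγ hgtC hgtL2 hk2 hpde2' hi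
  -- AM–GM at the two contacts
  have A0 := integral_pairings_le_cost hω hl hβ hT (hdg hB0) (hdgt hB0) hφ0 hχ0
  have AR := integral_pairings_le_cost hω hl hβ hT (hdg hBR) (hdgt hBR) hφR hχR
  rw [Rb i0] at A0
  rw [Rb iR] at AR
  -- assemble in Lebesgue form
  have hγT : 0 < γ * T := mul_pos hγ hT
  have key : (∫ x, partialP i0 g x ^ 2 * (pinnedChain ω₂ lam β γ).gibbsDensity L T x) + ∫ x, partialP iR g x ^ 2 * (pinnedChain ω₂ lam β γ).gibbsDensity L T x ≤
      ((∫ x, partialP i0 φ x ^ 2 * (pinnedChain ω₂ lam β γ).gibbsDensity L T x) + ∫ x, partialP iR φ x ^ 2 * (pinnedChain ω₂ lam β γ).gibbsDensity L T x) +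
      ((∫ x, partialP i0 χ x ^ 2 * (pinnedChain ω₂ lam β γ).gibbsDensity L T x) + ∫ x, partialP iR χ x ^ 2 * (pinnedChain ω₂ lam β γ).gibbsDensity L T x) := by
    -- (P1 + P2)/(γT) = the sum of the eight pairings = 2(E₀ + E_R)
    have hsum : γ * T * (((∫ x, partialP i0 g x * partialP i0 φ x * (pinnedChain ω₂ lam β γ).gibbsDensity L T x) +
        (∫ x, partialP i0 gt x * partialP i0 φ x * (pinnedChain ω₂ lam β γ).gibbsDensity L T x) +
        (∫ x, partialP i0 χ x * partialP i0 g x * (pinnedChain ω₂ lam β γ).gibbsDensity L T x) -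
        ∫ x, partialP i0 χ x * partialP i0 gt x * (pinnedChain ω₂ lam β γ).gibbsDensity L T x) +
        ((∫ x, partialP iR g x * partialP iR φ x * (pinnedChain ω₂ lam β γ).gibbsDensity L T x) +
        (∫ x, partialP iR gt x * partialP iR φ x * (pinnedChain ω₂ lam β γ).gibbsDensity L T x) +
        (∫ x, partialP iR χ x * partialP iR g x * (pinnedChain ω₂ lam β γ).gibbsDensity L T x) -
        ∫ x, partialP iR χ x * partialP iR gt x * (pinnedChain ω₂ lam β γ).gibbsDensity L T x)) =
        γ * T * (2 * ((∫ x, partialP i0 g x ^ 2 * (pinnedChain ω₂ lam β γ).gibbsDensity L T x) +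
          ∫ x, partialP iR g x ^ 2 * (pinnedChain ω₂ lam β γ).gibbsDensity L T x)) := by
      linear_combination P1 + P2 + 2 * D + R0
    have hsum' := mul_left_cancel₀ hγT.ne' hsum
    linarith [A0, AR, hsum']
  -- pass to μ_T = Z⁻¹ ρ dx
  have hZ : 0 < ∫ x, (pinnedChain ω₂ lam β γ).gibbsDensity L T x :=
    integral_exp_pos (pinnedChain_integrable_gibbsDensity hω hl hβ γ L hT)
  simp only [OscillatorChain.integral_gibbsMeasure]
  have hZi : 0 ≤ (∫ x, (pinnedChain ω₂ lam β γ).gibbsDensity L T x)⁻¹ := inv_nonneg.mpr hZ.le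
  have := mul_le_mul_of_nonneg_left key hZi
  linarith [this]

/-! ## §3 Certificates bound the far gradient, the floor and the crux -/

/-- **A certificate bounds the far-contact Dirichlet energy from below.**  For all parameters `> 0`, `T > 0`, `L ≥ 2`,
every classical MEAN-ZERO left forward field `g` and every admissible pair `(φ, χ)` with `χ ∈ L²(μ_T)`:
`‖∂_{p_{L−1}} g‖² ≥ (T/γ² − cost(φ,χ))/2`, `cost = Σ_b (‖∂_{p_b}φ‖² + ‖∂_{p_b}χ‖²)` — the certificate principle combined with
the landed sum rule `E_near = T/γ² − 3 E_far` (`nearGradient_sq_eq`).  The trivial pair `((p_0²−T)/(2γ), 0)` has cost `T/γ²`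
and certifies `E_far ≥ 0`; a pair of cost `≤ T/γ² − 2c/(L−1)` certifies the floor at `L`. [folklore] -/
theorem farGradient_sq_ge_of_certificate (hω : 0 < ω₂) (hl : 0 < lam) (hβ : 0 < β) (hγ : 0 < γ) (hT : 0 < T)
    {L : ℕ} (hL : 2 ≤ L) {g : PhaseSpace L → ℝ} (hgC : ContDiff ℝ 2 g)
    (hgL2 : MemLp g 2 ((pinnedChain ω₂ lam β γ).gibbsMeasure L T))
    (hg0 : ∫ x, g x ∂((pinnedChain ω₂ lam β γ).gibbsMeasure L T) = 0)
    (hgeq : ∀ x, (pinnedChain ω₂ lam β γ).generator L T T g x = -(kin L 0 x - T))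
    {φ χ : PhaseSpace L → ℝ} (hφ : ContDiff ℝ 2 φ) (hχ : ContDiff ℝ 2 χ)
    (hφ0 : MemLp (partialP (⟨0, by omega⟩ : Fin L) φ) 2 ((pinnedChain ω₂ lam β γ).gibbsMeasure L T))
    (hφR : MemLp (partialP (⟨L - 1, by omega⟩ : Fin L) φ) 2 ((pinnedChain ω₂ lam β γ).gibbsMeasure L T))
    (hχ0 : MemLp (partialP (⟨0, by omega⟩ : Fin L) χ) 2 ((pinnedChain ω₂ lam β γ).gibbsMeasure L T))
    (hχR : MemLp (partialP (⟨L - 1, by omega⟩ : Fin L) χ) 2 ((pinnedChain ω₂ lam β γ).gibbsMeasure L T))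
    (hχ2 : MemLp χ 2 ((pinnedChain ω₂ lam β γ).gibbsMeasure L T))
    (hpair : ∀ x, γ * bathOp L (OscillatorChain.bathWeight L) T φ x +
      liouvilleOp (pinnedChain ω₂ lam β γ) L χ x = -(kin L 0 x - T)) :
    (T / γ ^ 2 - (((∫ x, (partialP (⟨0, by omega⟩ : Fin L) φ x) ^ 2 ∂((pinnedChain ω₂ lam β γ).gibbsMeasure L T)) +
          ∫ x, (partialP (⟨L - 1, by omega⟩ : Fin L) φ x) ^ 2 ∂((pinnedChain ω₂ lam β γ).gibbsMeasure L T)) +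
        ((∫ x, (partialP (⟨0, by omega⟩ : Fin L) χ x) ^ 2 ∂((pinnedChain ω₂ lam β γ).gibbsMeasure L T)) +
          ∫ x, (partialP (⟨L - 1, by omega⟩ : Fin L) χ x) ^ 2 ∂((pinnedChain ω₂ lam β γ).gibbsMeasure L T)))) / 2 ≤
      ∫ x, (partialP (⟨L - 1, by omega⟩ : Fin L) g x) ^ 2 ∂((pinnedChain ω₂ lam β γ).gibbsMeasure L T) := by
  have hP := certificate_principle hω hl.le hβ.le hγ hT hL hgC hgL2 hgeq hφ hχ hφ0 hφR hχ0 hχR hχ2 hpair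
  have hS := nearGradient_sq_eq hω hl hβ hγ hT hL hgC hgL2 hg0 hgeq
  rw [hS] at hP
  linarith

/-- **Floor from certificates.**  If for all parameters `> 0` and `T > 0` there are `c > 0` and `L₁` such that every `L`-chain with
`L ≥ L₁` (`L ≥ 2`) carries an admissible pair of cost `≤ T/γ² − c/(L−1)`, then the transmission-gradient floor (the registered
stub `stub_transmissionGradientFloor` of line ForecastSensitivitySketch, ⟺ crux) holds with constant `c/2`. [folklore] -/
theorem floor_of_certificates
    (hC : ∀ (ω₂ lam β γ T : ℝ), 0 < ω₂ → 0 < lam → 0 < β → 0 < γ → 0 < T →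
      ∃ c : ℝ, 0 < c ∧ ∃ L₁ : ℕ, ∀ (L : ℕ) (hL : 2 ≤ L), L₁ ≤ L → ∃ φ χ : PhaseSpace L → ℝ,
        ContDiff ℝ 2 φ ∧ ContDiff ℝ 2 χ ∧
        MemLp (partialP (⟨0, by omega⟩ : Fin L) φ) 2 ((pinnedChain ω₂ lam β γ).gibbsMeasure L T) ∧
        MemLp (partialP (⟨L - 1, by omega⟩ : Fin L) φ) 2 ((pinnedChain ω₂ lam β γ).gibbsMeasure L T) ∧
        MemLp (partialP (⟨0, by omega⟩ : Fin L) χ) 2 ((pinnedChain ω₂ lam β γ).gibbsMeasure L T) ∧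
        MemLp (partialP (⟨L - 1, by omega⟩ : Fin L) χ) 2 ((pinnedChain ω₂ lam β γ).gibbsMeasure L T) ∧
        MemLp χ 2 ((pinnedChain ω₂ lam β γ).gibbsMeasure L T) ∧
        (∀ x, γ * bathOp L (OscillatorChain.bathWeight L) T φ x +
          liouvilleOp (pinnedChain ω₂ lam β γ) L χ x = -(kin L 0 x - T)) ∧
        ((∫ x, (partialP (⟨0, by omega⟩ : Fin L) φ x) ^ 2 ∂((pinnedChain ω₂ lam β γ).gibbsMeasure L T)) +
            ∫ x, (partialP (⟨L - 1, by omega⟩ : Fin L) φ x) ^ 2 ∂((pinnedChain ω₂ lam β γ).gibbsMeasure L T)) +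
          ((∫ x, (partialP (⟨0, by omega⟩ : Fin L) χ x) ^ 2 ∂((pinnedChain ω₂ lam β γ).gibbsMeasure L T)) +
            ∫ x, (partialP (⟨L - 1, by omega⟩ : Fin L) χ x) ^ 2 ∂((pinnedChain ω₂ lam β γ).gibbsMeasure L T)) ≤
          T / γ ^ 2 - c / ((L : ℝ) - 1)) :
    ∀ (ω₂ lam β γ T : ℝ), 0 < ω₂ → 0 < lam → 0 < β → 0 < γ → 0 < T →
      ∃ c : ℝ, 0 < c ∧ ∃ L₁ : ℕ, ∀ (L : ℕ) (hL : 2 ≤ L), L₁ ≤ L → ∀ g : PhaseSpace L → ℝ, ContDiff ℝ 2 g →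
        MemLp g 2 ((pinnedChain ω₂ lam β γ).gibbsMeasure L T) →
        ∫ x, g x ∂((pinnedChain ω₂ lam β γ).gibbsMeasure L T) = 0 →
        (∀ x, (pinnedChain ω₂ lam β γ).generator L T T g x = -(kin L 0 x - T)) →
        c ≤ ((L : ℝ) - 1) *
          ∫ x, (partialP (⟨L - 1, by omega⟩ : Fin L) g x) ^ 2 ∂((pinnedChain ω₂ lam β γ).gibbsMeasure L T) := by
  intro ω₂ lam β γ T hω hl hβ hγ hT
  obtain ⟨c, hc, L₁, hcert⟩ := hC ω₂ lam β γ T hω hl hβ hγ hT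
  refine ⟨c / 2, by positivity, L₁, fun L hL hL₁ g hgC hgL2 hg0 hgeq => ?_⟩
  obtain ⟨φ, χ, hφ, hχ, hφ0, hφR, hχ0, hχR, hχ2, hpair, hcost⟩ := hcert L hL hL₁
  have hfar := farGradient_sq_ge_of_certificate hω hl hβ hγ hT hL hgC hgL2 hg0 hgeq hφ hχ hφ0 hφR hχ0 hχR hχ2 hpair
  have hLpos : (0 : ℝ) < (L : ℝ) - 1 := by
    have : (2 : ℝ) ≤ L := by exact_mod_cast hL
    linarith
  -- (L−1) · (T/γ² − cost)/2 ≥ (L−1) · (c/(L−1))/2 = c/2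
  have h1 : c / ((L : ℝ) - 1) / 2 ≤ ∫ x, (partialP (⟨L - 1, by omega⟩ : Fin L) g x) ^ 2
      ∂((pinnedChain ω₂ lam β γ).gibbsMeasure L T) := by linarith
  calc c / 2 = ((L : ℝ) - 1) * (c / ((L : ℝ) - 1) / 2) := by field_simp
    _ ≤ ((L : ℝ) - 1) * ∫ x, (partialP (⟨L - 1, by omega⟩ : Fin L) g x) ^ 2
        ∂((pinnedChain ω₂ lam β γ).gibbsMeasure L T) := mul_le_mul_of_nonneg_left h1 hLpos.le

/-- **`ConductanceLowerBound` from certificates** — the inf-side variational route to the crux, kernel-checked end to end: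
admissible pairs of cost `≤ T/γ² − c/(L−1)` for all large `L` ⟹ floor (`floor_of_certificates`) ⟹ crux
(`conductanceLowerBound_of_floor`: Kubo link ∘ row sum ∘ Fisher square ∘ existence of forward fields).  By
`certificate_noGain_of_farFree` / `certificate_noGain_of_reversalEven` (companion file) such pairs must load the far thermostat
through `φ` and carry a reversal-odd `χ`. [folklore] -/
theorem conductanceLowerBound_of_certificates
    (hC : ∀ (ω₂ lam β γ T : ℝ), 0 < ω₂ → 0 < lam → 0 < β → 0 < γ → 0 < T →
      ∃ c : ℝ, 0 < c ∧ ∃ L₁ : ℕ, ∀ (L : ℕ) (hL : 2 ≤ L), L₁ ≤ L → ∃ φ χ : PhaseSpace L → ℝ,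
        ContDiff ℝ 2 φ ∧ ContDiff ℝ 2 χ ∧
        MemLp (partialP (⟨0, by omega⟩ : Fin L) φ) 2 ((pinnedChain ω₂ lam β γ).gibbsMeasure L T) ∧
        MemLp (partialP (⟨L - 1, by omega⟩ : Fin L) φ) 2 ((pinnedChain ω₂ lam β γ).gibbsMeasure L T) ∧
        MemLp (partialP (⟨0, by omega⟩ : Fin L) χ) 2 ((pinnedChain ω₂ lam β γ).gibbsMeasure L T) ∧
        MemLp (partialP (⟨L - 1, by omega⟩ : Fin L) χ) 2 ((pinnedChain ω₂ lam β γ).gibbsMeasure L T) ∧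
        MemLp χ 2 ((pinnedChain ω₂ lam β γ).gibbsMeasure L T) ∧
        (∀ x, γ * bathOp L (OscillatorChain.bathWeight L) T φ x +
          liouvilleOp (pinnedChain ω₂ lam β γ) L χ x = -(kin L 0 x - T)) ∧
        ((∫ x, (partialP (⟨0, by omega⟩ : Fin L) φ x) ^ 2 ∂((pinnedChain ω₂ lam β γ).gibbsMeasure L T)) +
            ∫ x, (partialP (⟨L - 1, by omega⟩ : Fin L) φ x) ^ 2 ∂((pinnedChain ω₂ lam β γ).gibbsMeasure L T)) +
          ((∫ x, (partialP (⟨0, by omega⟩ : Fin L) χ x) ^ 2 ∂((pinnedChain ω₂ lam β γ).gibbsMeasure L T)) +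
            ∫ x, (partialP (⟨L - 1, by omega⟩ : Fin L) χ x) ^ 2 ∂((pinnedChain ω₂ lam β γ).gibbsMeasure L T)) ≤
          T / γ ^ 2 - c / ((L : ℝ) - 1)) :
    Summit.AtomisticToContinuum.FouriersLaw.Theses.JunctionLocality.ConductanceLowerBound :=
  conductanceLowerBound_of_floor (floor_of_certificates hC)

/-- Registered helper sub-goal `helper_conductanceLowerBoundOfCertificates` of stub `stub_transmissionGradientFloor`
(= `conductanceLowerBound_of_certificates` in closed form; line ForecastSensitivitySketch, crux stmt-AtomisticToContinuum-11749). [folklore] -/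
theorem helper_conductanceLowerBoundOfCertificates : (∀ (ω₂ lam β γ T : ℝ), 0 < ω₂ → 0 < lam → 0 < β → 0 < γ → 0 < T → ∃ c : ℝ, 0 < c ∧ ∃ L₁ : ℕ, ∀ (L : ℕ) (hL : 2 ≤ L), L₁ ≤ L → ∃ φ χ : PhaseSpace L → ℝ, ContDiff ℝ 2 φ ∧ ContDiff ℝ 2 χ ∧ MemLp (partialP (⟨0, by omega⟩ : Fin L) φ) 2 ((pinnedChain ω₂ lam β γ).gibbsMeasure L T) ∧ MemLp (partialP (⟨L - 1, by omega⟩ : Fin L) φ) 2 ((pinnedChain ω₂ lam β γ).gibbsMeasure L T) ∧ MemLp (partialP (⟨0, by omega⟩ : Fin L) χ) 2 ((pinnedChain ω₂ lam β γ).gibbsMeasure L T) ∧ MemLp (partialP (⟨L - 1, by omega⟩ : Fin L) χ) 2 ((pinnedChain ω₂ lam β γ).gibbsMeasure L T) ∧ MemLp χ 2 ((pinnedChain ω₂ lam β γ).gibbsMeasure L T) ∧ (∀ x, γ * bathOp L (OscillatorChain.bathWeight L) T φ x + liouvilleOp (pinnedChain ω₂ lam β γ) L χ x = -(kin L 0 x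 - T)) ∧ ((∫ x, (partialP (⟨0, by omega⟩ : Fin L) φ x) ^ 2 ∂((pinnedChain ω₂ lam β γ).gibbsMeasure L T)) + ∫ x, (partialP (⟨L - 1, by omega⟩ : Fin L) φ x) ^ 2 ∂((pinnedChain ω₂ lam β γ).gibbsMeasure L T)) + ((∫ x, (partialP (⟨0, by omega⟩ : Fin L) χ x) ^ 2 ∂((pinnedChain ω₂ lam β γ).gibbsMeasure L T)) + ∫ x, (partialP (⟨L - 1, by omega⟩ : Fin L) χ x) ^ 2 ∂((pinnedChain ω₂ lam β γ).gibbsMeasure L T)) ≤ T / γ ^ 2 - c / ((L : ℝ) - 1)) → Summit.AtomisticToContinuum.FouriersLaw.Theses.JunctionLocality.ConductanceLowerBound :=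
  conductanceLowerBound_of_certificates

end Summit.AtomisticToContinuum.FouriersLaw.Cruxes.ConductanceLowerBound.ForecastSensitivity

end
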